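import Summits.RiemannHypothesis.RiemannHypothesis.Theses.RuelleBand
import Literature.Barriers.RiemannHypothesis.BohrDenseValuesProofs
import Literature.NumberTheory.LFunctions.GeneralizedRH

/-!
# `NribWeakRecurrenceToExact` (stmt-RiemannHypothesis-18195, route `RuelleBand`)

The GLUE of the BC2-redirect split of thesis X = `ExactFirstBand`: "no right-interior band"
(`NoRightInteriorBand`, stmt-RiemannHypothesis-18109) and weak shift-recurrence of `ζ` on the closed
discs of the half-strip `1/2 < σ < 1` (`ZetaWeakRecurrence`, stmt-RiemannHypothesis-18110) together
imply that every zero of `ζ` in the open critical strip lies on the critical line (or is real).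

Proof (Bagchi's argument, Steuding 2007 Thm. 8.3, with the density theorem replaced by
`NoRightInteriorBand` and positive density of returns replaced by unboundedly late returns): an
off-line zero `ξ`, w.l.o.g. `Re ξ > 1/2` by the functional equation, is isolated;
`NoRightInteriorBand` at `σ₀ = Re ξ` gives a window `|Re s − Re ξ| < ε₁` carrying finitely many
zeros, whose ordinates are therefore bounded by some `M`; with `δ` smaller than the isolation radius,
than the distance of `ξ` to the lines `σ = 1/2`, `σ = 1`, and than `ε₁`, and with
`ε := min_{|w−ξ|=δ} |ζ(w)| > 0`, a returning shift `τ ≥ M + δ + 1 − Im ξ` (weak recurrence)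
generates by Rouché (`Literature.Barriers.RiemannHypothesis.exists_zero_near_shift`, Steuding eq.
(8.5)) a zero `ρ` with `|ρ − ξ − iτ| < δ` — inside the window and of height `> M`: contradiction.

Main results:
* `NribWeakRecurrenceToExact.exactFirstBand_of_noRightInteriorBand_of_weakRecurrence` — the glue;
* `ruelleBand_nribWeakRecurrenceToExact_proof : NribWeakRecurrenceToExact` — the route decl by name.
-/

-- D-0017: single-problem summit; the lakefile turns this linter off for `Summits`; repeated here so that
-- standalone elaboration is warning-free as well.
set_option linter.dupNamespace false

noncomputable section

namespace Summit.RiemannHypothesis.RiemannHypothesis.Theorems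

open Complex Set Metric Filter Topology
open Summit.RiemannHypothesis.RiemannHypothesis.Theses.RuelleBand (ExactFirstBand
  NoRightInteriorBand ZetaWeakRecurrence NribWeakRecurrenceToExact)
open Literature.Barriers.RiemannHypothesis (exists_zero_near_shift)
open Literature.NumberTheory.LFunctions (GeneralizedRH.riemannZeta_one_sub_eq_zero)

namespace NribWeakRecurrenceToExact

/-- A zero `ξ` of `ζ` with `ξ ≠ 1` is ISOLATED: `ζ ≠ 0` on some punctured disc about `ξ`
(identity theorem on the connected set `ℂ ∖ {1}`, `ζ(2) ≠ 0`). [folklore] -/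
theorem exists_punctured_ball_zeta_ne_zero {ξ : ℂ} (hξne1 : ξ ≠ 1) :
    ∃ δ₁ > 0, ∀ w : ℂ, dist w ξ < δ₁ → w ≠ ξ → riemannZeta w ≠ 0 := by
  have han : AnalyticAt ℂ riemannZeta ξ := analyticOn_riemannZeta ξ hξne1
  have hev : ∀ᶠ w in 𝓝[≠] ξ, riemannZeta w ≠ 0 := by
    rcases han.eventually_eq_zero_or_eventually_ne_zero with h0' | hne'
    · exfalso
      have h2 : riemannZeta 2 = 0 :=
        analyticOn_riemannZeta.eqOn_zero_of_preconnected_of_eventuallyEq_zero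
          (isConnected_compl_singleton_of_one_lt_rank (by simp) (1 : ℂ)).isPreconnected hξne1 h0'
          (show (2 : ℂ) ∈ ({1}ᶜ : Set ℂ) by norm_num)
      exact riemannZeta_ne_zero_of_one_le_re (s := 2) (by norm_num) h2
    · exact hne'
  rw [eventually_nhdsWithin_iff, Metric.eventually_nhds_iff] at hev
  obtain ⟨δ₁, hδ₁, h⟩ := hev
  exact ⟨δ₁, hδ₁, fun w hw hne ↦ h hw hne⟩

/-- An off-line zero of the open strip yields one in the RIGHT half `1/2 < Re ξ < 1`
(reflect by `s ↦ 1 − s`, functional equation). [folklore] -/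
theorem exists_zero_right_half {s : ℂ} (hs : riemannZeta s = 0) (h0 : 0 < s.re) (h1 : s.re < 1)
    (hne : s.re ≠ 1 / 2) : ∃ ξ : ℂ, riemannZeta ξ = 0 ∧ 1 / 2 < ξ.re ∧ ξ.re < 1 := by
  rcases lt_or_gt_of_ne hne with hlt | hgt
  · refine ⟨1 - s, GeneralizedRH.riemannZeta_one_sub_eq_zero hs h0 h1, ?_, ?_⟩
    · simp only [sub_re, one_re]; linarith
    · simp only [sub_re, one_re]; linarith
  · exact ⟨s, hs, hgt, h1⟩

/-- THE GLUE (Bagchi / Steuding Thm. 8.3 with "no right-interior band" in place of the density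
theorem): `NoRightInteriorBand → ZetaWeakRecurrence → ExactFirstBand`.
[cite: Steuding2007, Thm. 8.3 (proof)] [cite: Bagchi1987, main theorem] -/
theorem exactFirstBand_of_noRightInteriorBand_of_weakRecurrence
    (hN : NoRightInteriorBand) (hW : ZetaWeakRecurrence) : ExactFirstBand := by
  intro s hs h0 h1
  by_contra hnot
  push Not at hnot
  obtain ⟨hne, -⟩ := hnot
  -- Step 0: an off-line zero `ξ` in the right half of the open strip
  obtain ⟨ξ, hξ0, hξhalf, hξ1⟩ := exists_zero_right_half hs h0 h1 hne
  -- Step 1: no right-interior band at `σ₀ = Re ξ`: a window with finitely many zeros, heights `≤ M`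
  obtain ⟨ε₁, hε₁, hfin⟩ := hN ξ.re hξhalf hξ1
  obtain ⟨M, hM⟩ := (hfin.image Complex.im).bddAbove
  -- Step 2: `ξ` is an isolated zero
  have hξne1 : ξ ≠ 1 := by
    intro h; rw [h, one_re] at hξ1; exact lt_irrefl _ hξ1
  obtain ⟨δ₁, hδ₁, hpunct⟩ := exists_punctured_ball_zeta_ne_zero hξne1
  -- Step 3: a radius `δ` (inside the punctured disc, inside the half-strip, inside the window)
  set m : ℝ := min (ξ.re - 1 / 2) (1 - ξ.re) with hmdef
  have hmpos : 0 < m := lt_min (by linarith) (by linarith)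
  set δ : ℝ := min (min (δ₁ / 2) (m / 2)) (ε₁ / 2) with hδdef
  have hδpos : 0 < δ := lt_min (lt_min (by linarith) (by linarith)) (by linarith)
  have hδ₁' : δ < δ₁ := ((min_le_left _ _).trans (min_le_left _ _)).trans_lt (by linarith)
  have hδm : δ < m := ((min_le_left _ _).trans (min_le_right _ _)).trans_lt (by linarith)
  have hδε₁ : δ < ε₁ := (min_le_right _ _).trans_lt (by linarith)
  have hδhalf : δ < ξ.re - 1 / 2 := hδm.trans_le (min_le_left _ _)
  have hδone : δ < 1 - ξ.re := hδm.trans_le (min_le_right _ _)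
  -- Step 4: `ε := min_{|w−ξ|=δ} |ζ(w)| > 0`
  have hcont : ContinuousOn (fun w ↦ ‖riemannZeta w‖) (sphere ξ δ) := by
    refine ContinuousOn.norm fun w hw ↦ ?_
    have hw1 : w ≠ 1 := by
      intro h
      rw [h, mem_sphere, dist_eq_norm] at hw
      have := abs_re_le_norm (1 - ξ)
      rw [hw, sub_re, one_re] at this
      rw [abs_le] at this
      linarith [this.1]
    exact (differentiableAt_riemannZeta hw1).continuousAt.continuousWithinAt
  obtain ⟨w₀, hw₀, hmin⟩ := (isCompact_sphere ξ δ).exists_isMinOn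
    (NormedSpace.sphere_nonempty.2 hδpos.le) hcont
  set ε : ℝ := ‖riemannZeta w₀‖ with hεdef
  have hεpos : 0 < ε := by
    rw [hεdef, norm_pos_iff]
    refine hpunct w₀ ?_ ?_
    · rw [mem_sphere.1 hw₀]; exact hδ₁'
    · intro h
      have := mem_sphere.1 hw₀
      rw [h, dist_self] at this
      exact hδpos.ne this
  have hεle : ∀ w ∈ sphere ξ δ, ε ≤ ‖riemannZeta w‖ := fun w hw ↦ hmin hw
  -- Step 5: a LATE returning shift (weak recurrence) and the zero it generates (Rouché)
  obtain ⟨τ, hτT, hτ⟩ := hW ξ δ hδpos hδm ε hεpos (M + δ + 1 - ξ.im)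
  obtain ⟨ρ, hρ0, hρdist⟩ := exists_zero_near_shift hξ0 hδpos (by linarith) hεle hτ
  -- Step 6: `ρ` lies in the window `|Re ρ − Re ξ| < ε₁` and has height `> M`: contradiction
  rw [dist_eq_norm] at hρdist
  have hre : |ρ.re - ξ.re| < δ := by
    have h := abs_re_le_norm (ρ - (ξ + τ * I))
    have h' : (ρ - (ξ + τ * I)).re = ρ.re - ξ.re := by
      simp only [sub_re, add_re, mul_re, ofReal_re, ofReal_im, I_re, I_im]; ring
    rw [h'] at h
    exact h.trans_lt hρdist
  have him : |ρ.im - (ξ.im + τ)| < δ := by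
    have h := abs_im_le_norm (ρ - (ξ + τ * I))
    have h' : (ρ - (ξ + τ * I)).im = ρ.im - (ξ.im + τ) := by
      simp only [sub_im, add_im, mul_im, ofReal_re, ofReal_im, I_re, I_im]; ring
    rw [h'] at h
    exact h.trans_lt hρdist
  have hre' := hre
  rw [abs_lt] at hre' him
  have hρmem :
      ρ ∈ {s : ℂ | riemannZeta s = 0 ∧ 0 < s.re ∧ s.re < 1 ∧ |s.re - ξ.re| < ε₁} :=
    ⟨hρ0, by linarith, by linarith, hre.trans hδε₁⟩
  have hle : ρ.im ≤ M := hM (Set.mem_image_of_mem Complex.im hρmem)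
  linarith

end NribWeakRecurrenceToExact

/-- Route item stmt-RiemannHypothesis-18195 by name: `NoRightInteriorBand → ZetaWeakRecurrence →
ExactFirstBand` (the glue of the BC2-redirect split of thesis X of route `RuelleBand`).
[cite: Steuding2007, Thm. 8.3 (proof)] [cite: Bagchi1987, main theorem] -/
theorem ruelleBand_nribWeakRecurrenceToExact_proof : NribWeakRecurrenceToExact := by
  unfold NribWeakRecurrenceToExact
  exact NribWeakRecurrenceToExact.exactFirstBand_of_noRightInteriorBand_of_weakRecurrence

end Summit.RiemannHypothesis.RiemannHypothesis.Theorems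

end
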